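import Literature.Probability.LatticeModels.AnnulusCrossing
import Literature.Probability.LatticeModels.CurrentExplorationWeights
import HarnessLib

/-!
# Towards the uniqueness of the crossing clusters (Aizenman–Duminil-Copin 2021, Lemma 4.4 / 6.2): walk arithmetic on spheres and paths off the backbone

Topic `Literature/Probability/LatticeModels`. Towards the implication "if `𝓜 ≠ ∅` but not `I_k`, then
one of `F₁, …, F₄` occurs" of the proof of Aizenman–Duminil-Copin 2021, Lemma 4.4 (arXiv:1912.07973,
p. 12; Lemma 6.2, p. 21), this file collects the deterministic ingredients about the backbone walk
`Current.explore` (Aizenman 1982, §9; `CurrentExploration.lean`) on a graph whose vertex type carries a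
pseudo-metric with integer distances to a centre `u` changing by at most one along edges
(`AnnulusCrossing.lean`):

* `Current.pos_exploreAt_succ_eq_or_adj` — consecutive sites of the walk are equal or adjacent;
* `Current.exists_pos_dist_eq_of_le` / `Current.exists_pos_dist_eq_of_ge` — **discrete intermediate
  values along the walk**: a walk reaching distance `≥ n` from a start at distance `≤ n` is exactly at
  distance `n` at some earlier time, and a walk coming back to distance `≤ ℓ` after being at distance
  `≥ ℓ` is exactly at distance `ℓ` at some intermediate time — so that the zigzag events `F₁`, `F₄`
  ("`Γ(n₁)` does two successive crossings of `Ann(ℓ_k, n)`") are zigzags through the two spheres, the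
  form bounded by the two-passage chain rule (`BackboneChainRuleTwo.lean`): `Current.zigzag_spheres_of_return`;
* `Current.cluster_eq_or_disjoint` — clusters of a current are equal or disjoint;
* `Current.not_mem_used_of_forall_not_mem_vis` — a bond avoiding the visited sites of the walk is not
  used by it (every used bond contains a visited site), hence (`Current.pos_onEdges_compl_of_avoid`) a bond
  avoiding the backbone carries in the off part `n 𝟙_{used(Γ)ᶜ}` the same current as in `n`: paths of
  the double current `n₁ + n₃` avoiding the sites of `Γ(n₁)` are paths of `(n₁ off Γ) + n₃` through the
  depleted graph — the reading of the events `F₂`, `F₃` ("`n₁+n₃` contains a cluster crossing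
  `Ann(n,m) ∖ Γ(n₁)`") bounded in `DepletedPairConnection.lean`.

No named fact is introduced; everything is proved.

## References

* M. Aizenman, H. Duminil-Copin, Ann. of Math. 194 (2021), arXiv:1912.07973, §4.2, proof of Lemma 4.4
  (events `F₁`–`F₄`, p. 12); §6.1, Lemma 6.2 [AizenmanDuminilCopinAnnals2021].
* M. Aizenman, Comm. Math. Phys. 86 (1982), §9 [AizenmanCMP1982] — through `CurrentExploration.lean`.
-/

noncomputable section

open Finset

namespace Literature.Probability.LatticeModels

variable {V : Type*} [Fintype V] [DecidableEq V] {G : SimpleGraph V} [DecidableRel G.Adj]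

namespace Current

variable {rk : G.edgeFinset → ℕ} {n : Current G} {Y : Finset V}

/-! ### Consecutive sites of the walk -/

/-- **Consecutive sites of the walk are equal or adjacent** (a move traverses the examined bond).
[folklore] -/
theorem pos_exploreAt_succ_eq_or_adj (a : V) (k : ℕ) :
    (exploreAt rk n Y a (k + 1)).pos = (exploreAt rk n Y a k).pos ∨
      G.Adj (exploreAt rk n Y a k).pos (exploreAt rk n Y a (k + 1)).pos := by
  rw [exploreAt_succ]
  set s := exploreAt rk n Y a k with hs
  rcases xstep_cases (rk := rk) (n := n) (Y := Y) s with ⟨-, h⟩ | ⟨-, -, h⟩ | ⟨-, -, hA, h⟩ | ⟨-, -, -, h⟩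
  · rw [h]; exact Or.inl rfl
  · rw [h]; exact Or.inl rfl
  · rw [h]
    set e := Function.argminOn rk (↑(availAt n s) : Set G.edgeFinset) hA with he
    have heA : s.pos ∈ (e : Sym2 V) := (mem_availAt.1 (argminOn_mem_availAt (rk := rk) hA)).1.1
    show (if Odd (n e) then otherEnd e s.pos else s.pos) = s.pos ∨
      G.Adj s.pos (if Odd (n e) then otherEnd e s.pos else s.pos)
    split_ifs
    · exact Or.inr (adj_otherEnd heA)
    · exact Or.inl rfl
  · rw [h]; exact Or.inl rfl

/-! ### Discrete intermediate values along the walk -/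

section Metric

variable [PseudoMetricSpace V] {u : V}

/-- One step of the walk changes the integer distance to `u` by at most one. [folklore] -/
theorem dist_pos_exploreAt_succ (hstep : ∀ v w, G.Adj v w → dist u w ≤ dist u v + 1) (a : V) (k : ℕ) :
    dist u (exploreAt rk n Y a (k + 1)).pos ≤ dist u (exploreAt rk n Y a k).pos + 1 ∧
      dist u (exploreAt rk n Y a k).pos ≤ dist u (exploreAt rk n Y a (k + 1)).pos + 1 := by
  rcases pos_exploreAt_succ_eq_or_adj (rk := rk) (n := n) (Y := Y) a k with h | h
  · rw [h]; constructor <;> linarith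
  · exact ⟨hstep _ _ h, hstep _ _ h.symm⟩

/-- **Going up, the walk passes exactly through every intermediate sphere**: if the walk starts at
distance `≤ N₀` and is at distance `≥ N₀` at time `t`, it is exactly at distance `N₀` at some time `≤ t`.
[folklore] -/
theorem exists_pos_dist_eq_of_le (hstep : ∀ v w, G.Adj v w → dist u w ≤ dist u v + 1)
    (hint : ∀ v, ∃ k : ℕ, dist u v = k) (a : V) {N₀ : ℕ} (ha : dist u a ≤ N₀) {t : ℕ}
    (ht : (N₀ : ℝ) ≤ dist u (exploreAt rk n Y a t).pos) :
    ∃ t', t' ≤ t ∧ dist u (exploreAt rk n Y a t').pos = N₀ := by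
  classical
  choose dn hdn using hint
  have hex : ∃ t', N₀ ≤ dn (exploreAt rk n Y a t').pos := ⟨t, by rw [hdn] at ht; exact_mod_cast ht⟩
  set t₀ := Nat.find hex with ht₀
  have h0 : N₀ ≤ dn (exploreAt rk n Y a t₀).pos := Nat.find_spec hex
  have hmin : ∀ j, j < t₀ → dn (exploreAt rk n Y a j).pos < N₀ := fun j hj => not_le.1 (Nat.find_min hex hj)
  have ht₀t : t₀ ≤ t := Nat.find_min' hex (by rw [hdn] at ht; exact_mod_cast ht)
  refine ⟨t₀, ht₀t, ?_⟩
  rw [hdn]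
  rcases Nat.eq_zero_or_pos t₀ with hz | hpos
  · -- at time `0` the walk is at `a`
    have : dn (exploreAt rk n Y a t₀).pos ≤ N₀ := by
      rw [hz, exploreAt_zero]
      show dn a ≤ N₀
      have := ha; rw [hdn] at this; exact_mod_cast this
    exact_mod_cast le_antisymm this h0
  · have hprev := hmin (t₀ - 1) (by omega)
    have hst := (dist_pos_exploreAt_succ (rk := rk) (n := n) (Y := Y) hstep a (t₀ - 1)).1
    rw [show t₀ - 1 + 1 = t₀ by omega, hdn, hdn] at hst
    have : dn (exploreAt rk n Y a t₀).pos ≤ dn (exploreAt rk n Y a (t₀ - 1)).pos + 1 := by exact_mod_cast hst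
    exact_mod_cast (le_antisymm (by omega) h0)

/-- **Coming back down, the walk passes exactly through the sphere**: if at time `t₁` the walk is at
distance `≥ ℓ₀` and at a later time `t₂` at distance `≤ ℓ₀`, then it is exactly at distance `ℓ₀` at some
time in `[t₁, t₂]`. [folklore] -/
theorem exists_pos_dist_eq_of_ge (hstep : ∀ v w, G.Adj v w → dist u w ≤ dist u v + 1)
    (hint : ∀ v, ∃ k : ℕ, dist u v = k) (a : V) {ℓ₀ : ℕ} {t₁ t₂ : ℕ} (h12 : t₁ ≤ t₂)
    (h1 : (ℓ₀ : ℝ) ≤ dist u (exploreAt rk n Y a t₁).pos) (h2 : dist u (exploreAt rk n Y a t₂).pos ≤ ℓ₀) :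
    ∃ t', t₁ ≤ t' ∧ t' ≤ t₂ ∧ dist u (exploreAt rk n Y a t').pos = ℓ₀ := by
  classical
  choose dn hdn using hint
  have hex : ∃ t', t₁ ≤ t' ∧ dn (exploreAt rk n Y a t').pos ≤ ℓ₀ :=
    ⟨t₂, h12, by rw [hdn] at h2; exact_mod_cast h2⟩
  set t₀ := Nat.find hex with ht₀
  obtain ⟨h0a, h0b⟩ : t₁ ≤ t₀ ∧ dn (exploreAt rk n Y a t₀).pos ≤ ℓ₀ := Nat.find_spec hex
  have hmin : ∀ j, j < t₀ → ¬ (t₁ ≤ j ∧ dn (exploreAt rk n Y a j).pos ≤ ℓ₀) := fun j hj => Nat.find_min hex hj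
  have ht₀t : t₀ ≤ t₂ := Nat.find_min' hex ⟨h12, by rw [hdn] at h2; exact_mod_cast h2⟩
  refine ⟨t₀, h0a, ht₀t, ?_⟩
  rw [hdn]
  have h1' : ℓ₀ ≤ dn (exploreAt rk n Y a t₁).pos := by rw [hdn] at h1; exact_mod_cast h1
  rcases (Nat.lt_or_ge t₁ t₀) with hlt | hge
  · -- `t₀ - 1 ≥ t₁` has distance `> ℓ₀`
    have hprev : ℓ₀ < dn (exploreAt rk n Y a (t₀ - 1)).pos := by
      have := hmin (t₀ - 1) (by omega)
      rw [not_and, not_le] at this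
      exact this (by omega)
    have hst := (dist_pos_exploreAt_succ (rk := rk) (n := n) (Y := Y) hstep a (t₀ - 1)).2
    rw [show t₀ - 1 + 1 = t₀ by omega, hdn, hdn] at hst
    have : dn (exploreAt rk n Y a (t₀ - 1)).pos ≤ dn (exploreAt rk n Y a t₀).pos + 1 := by exact_mod_cast hst
    exact_mod_cast le_antisymm h0b (by omega)
  · have heq : t₀ = t₁ := le_antisymm (by omega) h0a
    rw [heq] at h0b ⊢
    exact_mod_cast le_antisymm h0b h1'

/-- **A return is a zigzag through the spheres**: if the walk (from `a` with `dist(u,a) ≤ N₀`) is at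
distance `≥ N₀` at time `t₁` and at distance `≤ ℓ₀ ≤ N₀` at a later time `t₂`, then for some times
`s₁ ≤ s₂` it is exactly on the sphere of radius `N₀` at `s₁` and exactly on the sphere of radius `ℓ₀` at
`s₂` — the zigzag "to go from `0` to a vertex `v ∈ ∂Λ_n`, then to a vertex `w ∈ ∂Λ_{ℓ_k}`" of the event
`F₁`. [cite: AizenmanDuminilCopinAnnals2021, arXiv:1912.07973 §4.2, proof of Lemma 4.4 (event F₁) (p. 12)] -/
theorem zigzag_spheres_of_return (hstep : ∀ v w, G.Adj v w → dist u w ≤ dist u v + 1)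
    (hint : ∀ v, ∃ k : ℕ, dist u v = k) (a : V) {ℓ₀ N₀ : ℕ} (hℓN : ℓ₀ ≤ N₀) (ha : dist u a ≤ N₀)
    {t₁ t₂ : ℕ} (h12 : t₁ ≤ t₂) (h1 : (N₀ : ℝ) ≤ dist u (exploreAt rk n Y a t₁).pos)
    (h2 : dist u (exploreAt rk n Y a t₂).pos ≤ ℓ₀) :
    ∃ s₁ s₂, s₁ ≤ s₂ ∧ dist u (exploreAt rk n Y a s₁).pos = N₀ ∧ dist u (exploreAt rk n Y a s₂).pos = ℓ₀ := by
  obtain ⟨s₁, hs₁t, hs₁⟩ := exists_pos_dist_eq_of_le (rk := rk) (n := n) (Y := Y) hstep hint a ha h1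
  have h2' : dist u (exploreAt rk n Y a t₂).pos ≤ (ℓ₀ : ℝ) := h2
  obtain ⟨s₂, hs₁s₂, -, hs₂⟩ := exists_pos_dist_eq_of_ge (rk := rk) (n := n) (Y := Y) hstep hint a
    (ℓ₀ := ℓ₀) (hs₁t.trans h12) (by rw [hs₁]; exact_mod_cast hℓN) h2'
  exact ⟨s₁, s₂, hs₁s₂, hs₁, hs₂⟩

end Metric

/-! ### Clusters are equal or disjoint -/

omit [DecidableEq V] in
/-- **Two clusters of a current are equal or disjoint.** [folklore] -/
theorem cluster_eq_or_disjoint (m : Current G) (v w : V) :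
    m.cluster v = m.cluster w ∨ Disjoint (m.cluster v) (m.cluster w) := by
  by_cases h : Disjoint (m.cluster v) (m.cluster w)
  · exact Or.inr h
  · left
    rw [Finset.not_disjoint_iff] at h
    obtain ⟨t, htv, htw⟩ := h
    have hvw : w ∈ m.cluster v := mem_cluster_trans htv ((mem_cluster_comm).1 htw)
    ext z
    constructor
    · intro hz
      exact mem_cluster_trans ((mem_cluster_comm).1 hvw) hz
    · intro hz
      exact mem_cluster_trans hvw hz

/-! ### Paths off the backbone are paths of the off part -/

/-- **A bond avoiding the visited sites is not used by the walk** (every used bond contains a visited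
site, `exists_mem_vis_of_mem_used_explore`). [folklore] -/
theorem not_mem_used_of_forall_not_mem_vis (a : V) {e : G.edgeFinset}
    (h : ∀ v ∈ (e : Sym2 V), v ∉ (explore rk n Y a).vis) : e ∉ (explore rk n Y a).used := by
  intro he
  obtain ⟨v, hv, hve⟩ := exists_mem_vis_of_mem_used_explore (rk := rk) (n := n) (Y := Y) a he
  exact h v hve hv

/-- **The off part agrees with the current on the bonds avoiding the backbone's sites.** [folklore] -/
theorem onEdges_compl_used_apply_of_avoid (a : V) {e : G.edgeFinset}
    (h : ∀ v ∈ (e : Sym2 V), v ∉ (explore rk n Y a).vis) :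
    onEdges (explore rk n Y a).usedᶜ n e = n e :=
  onEdges_apply_of_mem n (mem_compl.2 (not_mem_used_of_forall_not_mem_vis a h))

/-- **An open edge of `n₁ + n₃` avoiding the sites of `Γ(n₁)` is an open edge of `(n₁ off Γ) + n₃`**
(the reading of "`n₁ + n₃` contains a cluster crossing `Ann(n,m) ∖ Γ(n₁)`" as an event on the off part
and the independent sourceless current). [cite: AizenmanDuminilCopinAnnals2021, arXiv:1912.07973 §4.2, proof of Lemma 4.4 (events F₂, F₃) (p. 12)] -/
theorem adj_off_add_of_adj_of_avoid (a : V) (n₃ : Current G) {z z' : V}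
    (hadj : (Percolation.openGraph (n + n₃).traced).Adj z z')
    (hz : z ∉ (explore rk n Y a).vis) (hz' : z' ∉ (explore rk n Y a).vis) :
    (Percolation.openGraph (onEdges (explore rk n Y a).usedᶜ n + n₃).traced).Adj z z' := by
  rw [Percolation.openGraph_adj] at hadj ⊢
  obtain ⟨⟨he, hpos⟩, hne⟩ := hadj
  refine ⟨⟨he, ?_⟩, hne⟩
  have havoid : ∀ v ∈ ((⟨s(z, z'), he⟩ : G.edgeFinset) : Sym2 V), v ∉ (explore rk n Y a).vis := by
    intro v hv
    rcases Sym2.mem_iff.1 hv with rfl | rfl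
    exacts [hz, hz']
  simp only [Pi.add_apply] at hpos ⊢
  rw [onEdges_compl_used_apply_of_avoid a havoid]
  exact hpos

/-- The bond of such an edge lies in the depleted graph (it is not a used bond). [folklore] -/
theorem not_mem_used_of_adj_of_avoid (a : V) {z z' : V} (he : s(z, z') ∈ G.edgeFinset)
    (hz : z ∉ (explore rk n Y a).vis) (hz' : z' ∉ (explore rk n Y a).vis) :
    (⟨s(z, z'), he⟩ : G.edgeFinset) ∉ (explore rk n Y a).used :=
  not_mem_used_of_forall_not_mem_vis a fun v hv => by
    rcases Sym2.mem_iff.1 hv with rfl | rfl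
    exacts [hz, hz']

end Current

end Literature.Probability.LatticeModels
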